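import Mathlib.Analysis.SpecialFunctions.Log.Basic
import Mathlib.Analysis.SpecialFunctions.Exp
import Mathlib.Algebra.BigOperators.Intervals
import HarnessLib

/-!
# ζ(5) search — growth and Casoratian of second-order recurrences (cell `pub-zeta5`, TYPER)

HONEST FRAMING: systematic search; no irrationality claim unless certified.

Generic, Poincaré–Perron-free tools that turn a second-order linear recurrence
`y (n+2) = s n · y (n+1) - t n · y n` (the Apéry / Zeilberger–Zudilin shape, `s n = P₁(n)/P₂(n)`,
`t n = P₀(n)/P₂(n)`) into the finitary fields of the cell's recurrence-first certificate
`ApproximationCertificate` (`ApproximationCertificate.lean`; cell `CRITERIA.md`, FORMAT A):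

* `casoratian_succ`, `casoratian_eq_prod_mul` — **Abel's formula**: for two solutions `u, v` the
  Casoratian `W n = u n · v (n+1) - u (n+1) · v n` satisfies `W (n+1) = t n · W n`, hence
  `W n = (∏_{N ≤ i < n} t i) · W N` — so `casorati_le` / `casorati_ne` are identities;
* `ratio_bounds_of_recurrence` — **ratio induction**: if `t n ≥ 0` and rational brackets
  `0 < λ ≤ Λ` satisfy `λ + t n/λ ≤ s n ≤ Λ + t n/Λ` for `n ≥ N` (i.e. `λ, Λ` enclose the dominant
  root of `x² - s x + t`), and the two initial ratios lie in `[λ, Λ]`, then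
  `λ u n ≤ u (n+1) ≤ Λ u n` and `u n > 0` for all `n ≥ N` (this is how the tree bounds Apéry's
  `q_{n,n}`, `Literature.NumberTheory.Transcendental.Apery.qT_diag_growth`, made generic);
* `le_of_ratio_lower`, `le_of_ratio_upper`, `eventually_exp_le_of_ratio`,
  `eventually_le_exp_of_ratio` — from ratio bounds to `u N λ^{n-N} ≤ u n ≤ u N Λ^{n-N}` and to the
  certificate fields `e^{Q n} ≤ u n` (`Q < log λ`), `u n ≤ e^{Q' n}` (`log Λ < Q'`) for large `n`;
* `ratio_bounds_of_recurrence_neg` — the same ratio induction when `t n ≤ 0` (decreasing ratio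
  map; Zudilin 2003 / Catalan shape): invariance of `[λ, Λ]` iff `λ ≤ s n - t n/Λ` and
  `s n - t n/λ ≤ Λ` (appended by typer g2).

Everything is PROVED; no definitions, no named facts. Pure sequence lemmas (no `ζ`-specific input).
-/

noncomputable section

open Filter Topology Finset

namespace Summit.KontsevichZagierPeriods.Zeta5Search

/-! ### Abel's formula for the Casoratian -/

/-- **Abel's formula, one step.** Two solutions `u, v` of `y (n+2) = s n y (n+1) - t n y n` have
`u (n+1) v (n+2) - u (n+2) v (n+1) = t n · (u n v (n+1) - u (n+1) v n)`. -/
theorem casoratian_succ {R : Type*} [CommRing R] (u v s t : ℕ → R) (n : ℕ)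
    (hu : u (n + 2) = s n * u (n + 1) - t n * u n)
    (hv : v (n + 2) = s n * v (n + 1) - t n * v n) :
    u (n + 1) * v (n + 2) - u (n + 2) * v (n + 1) =
      t n * (u n * v (n + 1) - u (n + 1) * v n) := by
  rw [hu, hv]; ring

/-- **Abel's formula.** For two solutions `u, v` of `y (n+2) = s n y (n+1) - t n y n` (`n ≥ N`),
the Casoratian is `u n v (n+1) - u (n+1) v n = (∏_{i ∈ [N, n)} t i) · (u N v (N+1) - u (N+1) v N)`
for all `n ≥ N`. -/
theorem casoratian_eq_prod_mul {R : Type*} [CommRing R] (u v s t : ℕ → R) (N : ℕ)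
    (hu : ∀ n, N ≤ n → u (n + 2) = s n * u (n + 1) - t n * u n)
    (hv : ∀ n, N ≤ n → v (n + 2) = s n * v (n + 1) - t n * v n) :
    ∀ n, N ≤ n → u n * v (n + 1) - u (n + 1) * v n =
      (∏ i ∈ Ico N n, t i) * (u N * v (N + 1) - u (N + 1) * v N) := by
  refine Nat.le_induction (by simp) fun n hn ih => ?_
  rw [show n + 1 + 1 = n + 2 by ring, casoratian_succ u v s t n (hu n hn) (hv n hn), ih,
    Finset.prod_Ico_succ_top hn]
  ring

/-! ### Ratio induction -/

/-- **Ratio induction for a second-order recurrence.** Let `u (n+2) = s n u (n+1) - t n u n` for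
`n ≥ N` with `t n ≥ 0`, and let `0 < λ ≤ Λ` satisfy `λ + t n/λ ≤ s n ≤ Λ + t n/Λ` for `n ≥ N`.
If `u N > 0` and `λ u N ≤ u (N+1) ≤ Λ u N`, then for every `n ≥ N`:
`u n > 0` and `λ u n ≤ u (n+1) ≤ Λ u n`. -/
theorem ratio_bounds_of_recurrence (u s t : ℕ → ℝ) {lam Lam : ℝ} (N : ℕ)
    (hrec : ∀ n, N ≤ n → u (n + 2) = s n * u (n + 1) - t n * u n)
    (ht : ∀ n, N ≤ n → 0 ≤ t n) (hlam : 0 < lam) (hLam : lam ≤ Lam)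
    (hlow : ∀ n, N ≤ n → lam + t n / lam ≤ s n) (hup : ∀ n, N ≤ n → s n ≤ Lam + t n / Lam)
    (h0 : 0 < u N) (h1 : lam * u N ≤ u (N + 1)) (h1' : u (N + 1) ≤ Lam * u N) :
    ∀ n, N ≤ n → 0 < u n ∧ lam * u n ≤ u (n + 1) ∧ u (n + 1) ≤ Lam * u n := by
  have hLam0 : 0 < Lam := hlam.trans_le hLam
  refine Nat.le_induction ⟨h0, h1, h1'⟩ fun n hn ih => ?_
  obtain ⟨hpos, hlo, hhi⟩ := ih
  have hpos1 : 0 < u (n + 1) := (mul_pos hlam hpos).trans_le hlo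
  refine ⟨hpos1, ?_, ?_⟩
  · -- `u (n+2) = s u(n+1) - t u n ≥ (s - t/λ) u (n+1) ≥ λ u (n+1)`
    rw [show n + 1 + 1 = n + 2 by ring, hrec n hn]
    have hun : u n ≤ u (n + 1) / lam := by rw [le_div_iff₀ hlam]; linarith
    have h2 : t n * u n ≤ t n * (u (n + 1) / lam) := mul_le_mul_of_nonneg_left hun (ht n hn)
    have h3 : (lam + t n / lam) * u (n + 1) ≤ s n * u (n + 1) :=
      mul_le_mul_of_nonneg_right (hlow n hn) hpos1.le
    have e : (lam + t n / lam) * u (n + 1) = lam * u (n + 1) + t n * (u (n + 1) / lam) := by ring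
    linarith
  · -- `u (n+2) = s u(n+1) - t u n ≤ (s - t/Λ) u (n+1) ≤ Λ u (n+1)`
    rw [show n + 1 + 1 = n + 2 by ring, hrec n hn]
    have hun : u (n + 1) / Lam ≤ u n := by rw [div_le_iff₀ hLam0]; linarith
    have h2 : t n * (u (n + 1) / Lam) ≤ t n * u n := mul_le_mul_of_nonneg_left hun (ht n hn)
    have h3 : s n * u (n + 1) ≤ (Lam + t n / Lam) * u (n + 1) :=
      mul_le_mul_of_nonneg_right (hup n hn) hpos1.le
    have e : (Lam + t n / Lam) * u (n + 1) = Lam * u (n + 1) + t n * (u (n + 1) / Lam) := by ring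
    linarith

/-! ### From ratio bounds to exponential bounds -/

/-- A lower ratio bound `λ u n ≤ u (n+1)` (`n ≥ N`, `λ ≥ 0`) gives `u N λ^{n-N} ≤ u n`, stated as
`u N λ^m ≤ u (N + m)`. -/
theorem le_of_ratio_lower (u : ℕ → ℝ) {lam : ℝ} (N : ℕ) (hlam : 0 ≤ lam)
    (h : ∀ n, N ≤ n → lam * u n ≤ u (n + 1)) : ∀ m : ℕ, u N * lam ^ m ≤ u (N + m) := by
  intro m
  induction m with
  | zero => simp
  | succ m ih =>
    calc u N * lam ^ (m + 1) = lam * (u N * lam ^ m) := by ring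
      _ ≤ lam * u (N + m) := mul_le_mul_of_nonneg_left ih hlam
      _ ≤ u (N + m + 1) := h (N + m) (Nat.le_add_right N m)
      _ = u (N + (m + 1)) := by rw [Nat.add_assoc]

/-- An upper ratio bound `u (n+1) ≤ Λ u n` (`n ≥ N`, `Λ ≥ 0`) gives `u (N + m) ≤ u N Λ^m`. -/
theorem le_of_ratio_upper (u : ℕ → ℝ) {Lam : ℝ} (N : ℕ) (hLam : 0 ≤ Lam)
    (h : ∀ n, N ≤ n → u (n + 1) ≤ Lam * u n) : ∀ m : ℕ, u (N + m) ≤ u N * Lam ^ m := by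
  intro m
  induction m with
  | zero => simp
  | succ m ih =>
    calc u (N + (m + 1)) = u (N + m + 1) := by rw [Nat.add_assoc]
      _ ≤ Lam * u (N + m) := h (N + m) (Nat.le_add_right N m)
      _ ≤ Lam * (u N * Lam ^ m) := mul_le_mul_of_nonneg_left ih hLam
      _ = u N * Lam ^ (m + 1) := by ring

/-- **Certificate field `growth_lower` from a ratio bound.** If `u N > 0` and `λ u n ≤ u (n+1)`
for `n ≥ N` with `λ > 0`, then for every `Q < log λ`: `e^{Q n} ≤ u n` for all large `n`. -/
theorem eventually_exp_le_of_ratio (u : ℕ → ℝ) {lam : ℝ} (N : ℕ) (hlam : 0 < lam) (h0 : 0 < u N)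
    (h : ∀ n, N ≤ n → lam * u n ≤ u (n + 1)) {Q : ℝ} (hQ : Q < Real.log lam) :
    ∀ᶠ n : ℕ in atTop, Real.exp (Q * n) ≤ u n := by
  -- `u n ≥ u N λ^{-N} · λ^n = e^{c + n log λ}` with `c = log (u N) - N log λ`; and
  -- `Q n ≤ c + n log λ` for large `n` since `log λ - Q > 0`.
  have hgap : 0 < Real.log lam - Q := by linarith
  have hev : ∀ᶠ n : ℕ in atTop, (N : ℝ) * Real.log lam - Real.log (u N) ≤ (Real.log lam - Q) * n :=
    (tendsto_natCast_atTop_atTop.const_mul_atTop hgap).eventually_ge_atTop _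
  filter_upwards [hev, eventually_ge_atTop N] with n hn hnN
  obtain ⟨m, rfl⟩ : ∃ m, n = N + m := ⟨n - N, by omega⟩
  have h1 : u N * lam ^ m ≤ u (N + m) := le_of_ratio_lower u N hlam.le h m
  refine le_trans ?_ h1
  -- compare logarithms
  rw [← Real.exp_log (mul_pos h0 (pow_pos hlam m)), Real.exp_le_exp, Real.log_mul h0.ne'
    (pow_pos hlam m).ne', Real.log_pow]
  have h3 : ((N + m : ℕ) : ℝ) = N + m := by push_cast; ring
  rw [h3] at hn ⊢
  nlinarith

/-- **Certificate field `growth_upper` from a ratio bound.** If `u n > 0` and `u (n+1) ≤ Λ u n`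
for `n ≥ N` with `Λ > 0`, then for every `Q' > log Λ`: `u n ≤ e^{Q' n}` for all large `n`. -/
theorem eventually_le_exp_of_ratio (u : ℕ → ℝ) {Lam : ℝ} (N : ℕ) (hLam : 0 < Lam) (h0 : 0 < u N)
    (h : ∀ n, N ≤ n → u (n + 1) ≤ Lam * u n) {Q' : ℝ} (hQ' : Real.log Lam < Q') :
    ∀ᶠ n : ℕ in atTop, u n ≤ Real.exp (Q' * n) := by
  have hgap : 0 < Q' - Real.log Lam := by linarith
  have hev : ∀ᶠ n : ℕ in atTop, Real.log (u N) - (N : ℝ) * Real.log Lam ≤ (Q' - Real.log Lam) * n :=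
    (tendsto_natCast_atTop_atTop.const_mul_atTop hgap).eventually_ge_atTop _
  filter_upwards [hev, eventually_ge_atTop N] with n hn hnN
  obtain ⟨m, rfl⟩ : ∃ m, n = N + m := ⟨n - N, by omega⟩
  have h1 : u (N + m) ≤ u N * Lam ^ m := le_of_ratio_upper u N hLam.le h m
  refine h1.trans ?_
  rw [← Real.exp_log (mul_pos h0 (pow_pos hLam m)), Real.exp_le_exp, Real.log_mul h0.ne'
    (pow_pos hLam m).ne', Real.log_pow]
  have h3 : ((N + m : ℕ) : ℝ) = N + m := by push_cast; ring
  rw [h3] at hn ⊢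
  nlinarith

/-! ### Ratio induction when `t n ≤ 0` (dominant root of `x² - s x + t` with `t < 0`) -/

/-- **Ratio induction, second order, `t n ≤ 0`** (recurrences `y (n+2) = s n y (n+1) + |t n| y n`
with both coefficients nonnegative, e.g. Zudilin's 2003 recursion for Catalan's constant whose
characteristic polynomial `x² - 11x - 1` has roots of opposite signs). Then the ratio map
`r ↦ s n - t n / r` is DECREASING, and the box `[λ, Λ]` (`0 < λ ≤ Λ`) is invariant as soon as
`λ ≤ s n - t n/Λ` and `s n - t n/λ ≤ Λ` for `n ≥ N`; with `u N > 0` and `λ u N ≤ u (N+1) ≤ Λ u N`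
one gets `u n > 0` and `λ u n ≤ u (n+1) ≤ Λ u n` for every `n ≥ N`. -/
theorem ratio_bounds_of_recurrence_neg (u s t : ℕ → ℝ) {lam Lam : ℝ} (N : ℕ)
    (hrec : ∀ n, N ≤ n → u (n + 2) = s n * u (n + 1) - t n * u n)
    (ht : ∀ n, N ≤ n → t n ≤ 0) (hlam : 0 < lam) (hLam : lam ≤ Lam)
    (hlow : ∀ n, N ≤ n → lam ≤ s n - t n / Lam) (hup : ∀ n, N ≤ n → s n - t n / lam ≤ Lam)
    (h0 : 0 < u N) (h1 : lam * u N ≤ u (N + 1)) (h1' : u (N + 1) ≤ Lam * u N) :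
    ∀ n, N ≤ n → 0 < u n ∧ lam * u n ≤ u (n + 1) ∧ u (n + 1) ≤ Lam * u n := by
  have hLam0 : 0 < Lam := hlam.trans_le hLam
  refine Nat.le_induction ⟨h0, h1, h1'⟩ fun n hn ih => ?_
  obtain ⟨hpos, hlo, hhi⟩ := ih
  have hpos1 : 0 < u (n + 1) := (mul_pos hlam hpos).trans_le hlo
  have htn : 0 ≤ -t n := by linarith [ht n hn]
  refine ⟨hpos1, ?_, ?_⟩
  · -- `u (n+2) = s u(n+1) + |t| u n ≥ s u(n+1) + |t| u(n+1)/Λ = (s - t/Λ) u(n+1) ≥ λ u(n+1)`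
    rw [show n + 1 + 1 = n + 2 by ring, hrec n hn]
    have hun : u (n + 1) / Lam ≤ u n := by rw [div_le_iff₀ hLam0]; linarith
    have h2 : -t n * (u (n + 1) / Lam) ≤ -t n * u n := mul_le_mul_of_nonneg_left hun htn
    have h3 : (lam : ℝ) * u (n + 1) ≤ (s n - t n / Lam) * u (n + 1) :=
      mul_le_mul_of_nonneg_right (hlow n hn) hpos1.le
    have e : (s n - t n / Lam) * u (n + 1) = s n * u (n + 1) + -t n * (u (n + 1) / Lam) := by ring
    linarith
  · -- `u (n+2) ≤ s u(n+1) + |t| u(n+1)/λ = (s - t/λ) u(n+1) ≤ Λ u(n+1)`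
    rw [show n + 1 + 1 = n + 2 by ring, hrec n hn]
    have hun : u n ≤ u (n + 1) / lam := by rw [le_div_iff₀ hlam]; linarith
    have h2 : -t n * u n ≤ -t n * (u (n + 1) / lam) := mul_le_mul_of_nonneg_left hun htn
    have h3 : (s n - t n / lam) * u (n + 1) ≤ Lam * u (n + 1) :=
      mul_le_mul_of_nonneg_right (hup n hn) hpos1.le
    have e : (s n - t n / lam) * u (n + 1) = s n * u (n + 1) + -t n * (u (n + 1) / lam) := by ring
    linarith

end Summit.KontsevichZagierPeriods.Zeta5Search
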